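import Literature.MathematicalPhysics.QuantumLattice.HubbardTTPrimeFreeKineticBound
import HarnessLib

/-!
# The free-fermion (`U = 0`) ground-state energy of the Hubbard model on the torus is the
# Fermi-sea sum: the bathtub lower bound and the plane-wave Slater upper bound coincide

Topic `MathematicalPhysics/QuantumLattice`, family `hubbard`. Written by the literature seat of the
folded cell `pub-mbboot` / speedrun `sr-mbsolver` (certified many-body solver): the speedrun's SDP
certificates are run at `U = 0` as CONTROLS, and the cell's free-fermion rows record only the two
inequalities. This file closes the loop IN THE TREE: for the Hubbard Hamiltonian
`H(t,U) = -t Σ (c†c + h.c.) + U Σ n↑n↓` on the discrete torus `(ℤ/Lℤ)^d`, `L ≥ 3`, at `U = 0`,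

* **`FreeFermionTorus.hubbardTorus_groundEnergyAt_zero_eq`** — for every real `t`, every `μ` and
  every pair of momentum sets `S↑, S↓ ⊆ (ℤ/Lℤ)^d` that are FERMI SEAS at level `μ` (each contains
  every plane wave with `ε_k < μ` and no plane wave with `ε_k > μ`; plane waves with `ε_k = μ` may be
  distributed freely), the canonical ground-state energy in the sector `N = |S↑| + |S↓|` is EXACTLY the
  Fermi-sea sum: `E_N(t, 0) = Σ_{k∈S↑} ε_k + Σ_{k∈S↓} ε_k`, `ε_k = -2t Σᵢ cos(2πkᵢ/L)`.
  PROOF = the two tree inequalities: the Lieb–Loss bathtub / Peierls lower bound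
  `μN + 2Σ_k min(ε_k - μ, 0) ≤ E_N` (`FreeKinetic.hubbardTorus_groundEnergyAt_ge`, [LiebLoss2001 Thm 1.14
  bathtub; Friedli–Velenik §10.5.2]) and the plane-wave Slater-determinant upper bound
  (`HartreeFock.hubbardTorus_groundEnergyAt_le_freeFermion_momentum`, [BachLiebSolovej1994 (2c.36)]),
  together with the finitary Fermi-level identity `Σ_k min(ε_k - μ, 0) = Σ_{k∈S}(ε_k - μ)`
  (`sum_min_sub_eq_of_fermiLevel`). This is the textbook statement that the non-interacting
  ground state is the filled Fermi sea (e.g. [cite: LiebLoss1993, §8, Theorem 8.2];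
  [cite: FriedliVelenikSMLS2017, §10.5.2]); the tree previously recorded only `≥` and `≤`
  (`HubbardTTPrimeFreeKineticBound` §3: "at `U = 0` these are equalities — the Fermi sea — though
  only the inequality is recorded").
* **`hubbardTorus44_groundEnergyAt_one_zero_sixteen`**, **`…_fourteen`** — the `4 × 4` torus at
  `t = 1`, `U = 0`: `E_16 = -24` and `E_14 = -24` EXACTLY (levels `-4` ×1, `-2` ×4, `0` ×6, `2` ×4,
  `4` ×1 per spin; the half-filled and the 7/8-filled Fermi seas differ only inside the zero shell),
  i.e. kernel values for the cell's `4 × 4`, `U = 0` control rows (lower side = the tree's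
  `groundEnergy_hubbardTorusTT'_four_N16_ge` / `…_N14_ge` at `t' = 0`; upper side = explicit momentum
  sets).

Everything is PROVED; no definitions, no named facts. HONEST FRAMING (cell): first certified bounds;
not a superconductivity verdict; every number certified or labelled float.

## References
* E. H. Lieb, M. Loss, *Analysis* (AMS, 2nd ed. 2001), Thm 1.14 (bathtub principle); E. H. Lieb,
  M. Loss, Duke Math. J. 71 (1993) 337, §8 Thm 8.2 [LiebLoss1993].
* S. Friedli, Y. Velenik, *Statistical Mechanics of Lattice Systems* (CUP 2017), §10.5.2 (free
  lattice fermions / plane waves on the torus) [FriedliVelenikSMLS2017].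
* V. Bach, E. H. Lieb, J. P. Solovej, J. Stat. Phys. 76 (1994) 3, eq. (2c.36) (energy of a Slater
  determinant) [BachLiebSolovej1994].
* D. Berenstein, P. N. T. Lloyd, arXiv:2606.02013 (2026): exactness of positivity (SDP) relaxations
  for free fermions — the bootstrap-side counterpart of this identity [BerensteinLloyd2026].
-/

noncomputable section

namespace Literature.MathematicalPhysics.QuantumLattice

namespace FreeFermionTorus

open Finset Literature.Probability.LatticeModels
  Literature.MathematicalPhysics.QuantumLattice.LangerMattis
  Literature.MathematicalPhysics.QuantumLattice.HartreeFock
  Literature.MathematicalPhysics.QuantumLattice.FreeKinetic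
  Literature.MathematicalPhysics.QuantumLattice.TTPrimeFree

/-! ### §1 The Fermi-level identity and the exact free-fermion energy on `(ℤ/Lℤ)^d` -/

/-- **Fermi-level identity.** If `S` contains every index with `ε_k < μ` and no index with
`ε_k > μ` (i.e. `ε_k ≤ μ` on `S` and `μ ≤ ε_k` off `S`), then
`Σ_k min(ε_k - μ, 0) = Σ_{k∈S} ε_k - μ|S|`. [folklore] -/
private theorem sum_min_sub_eq_of_fermiLevel {ι : Type*} [Fintype ι] [DecidableEq ι] (ε : ι → ℝ) (μ : ℝ)
    (S : Finset ι) (hin : ∀ k ∈ S, ε k ≤ μ) (hout : ∀ k ∉ S, μ ≤ ε k) :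
    ∑ k, min (ε k - μ) 0 = ∑ k ∈ S, ε k - μ * S.card := by
  classical
  rw [← Finset.sum_add_sum_compl S]
  have h1 : ∑ k ∈ S, min (ε k - μ) 0 = ∑ k ∈ S, (ε k - μ) :=
    Finset.sum_congr rfl fun k hk => min_eq_left (by linarith [hin k hk])
  have h2 : ∑ k ∈ Sᶜ, min (ε k - μ) 0 = 0 :=
    Finset.sum_eq_zero fun k hk => min_eq_right (by linarith [hout k (Finset.mem_compl.mp hk)])
  rw [h1, h2, add_zero, Finset.sum_sub_distrib, Finset.sum_const, nsmul_eq_mul]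
  ring

variable {d L : ℕ} [NeZero L]

/-- `|(ℤ/Lℤ)^d| = L^d`, so two momentum sets never hold more than `2L^d` plane waves. [folklore] -/
private theorem card_add_card_le_two_mul_pow (Sup Sdn : Finset (TorusSite d L)) :
    Sup.card + Sdn.card ≤ 2 * L ^ d := by
  have hc : Fintype.card (TorusSite d L) = L ^ d := by simp [Fintype.card_pi, ZMod.card]
  have h1 : Sup.card ≤ L ^ d := hc ▸ Finset.card_le_univ Sup
  have h2 : Sdn.card ≤ L ^ d := hc ▸ Finset.card_le_univ Sdn
  omega

/-- The plane-wave level in the two tree normal forms: the Lieb–Loss / SDW form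
`sdwBand t (cellCorner z)` used by `FreeKinetic.hubbardTorus_groundEnergyAt_ge` equals
`ε_z = -2t Σᵢ cos(2πzᵢ/L)`. [folklore] -/
private theorem sdwBand_cellCorner_eq (t : ℝ) (z : TorusSite d L) :
    sdwBand t (cellCorner z) = -(t * (2 * ∑ i, Real.cos (latticeMomentum L z i))) := by
  rw [← siteBand_neg_ofTorusSite_eq_sdwBand, siteBand_neg_ofTorusSite]

/-- **The free-fermion ground-state energy on the torus is the Fermi-sea sum** (`U = 0`, every real
`t`, every `d`, `L ≥ 3`). Let `S↑, S↓ ⊆ (ℤ/Lℤ)^d` be Fermi seas at a common level `μ`: `ε_k ≤ μ` for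
`k ∈ S_σ` and `μ ≤ ε_k` for `k ∉ S_σ` (`ε_k = -2t Σᵢ cos(2πkᵢ/L)`). Then
`E_{|S↑|+|S↓|}(t, U = 0) = Σ_{k∈S↑} ε_k + Σ_{k∈S↓} ε_k`.
Lower bound: Lieb–Loss bathtub at level `μ`; upper bound: the plane-wave Slater determinant.
[cite: LiebLoss1993, §8, Theorem 8.2][cite: BachLiebSolovej1994, eq. (2c.36)] -/
theorem hubbardTorus_groundEnergyAt_zero_eq (hL : 3 ≤ L) (t μ : ℝ) (Sup Sdn : Finset (TorusSite d L))
    (hup : ∀ k ∈ Sup, -(t * (2 * ∑ i, Real.cos (latticeMomentum L k i))) ≤ μ)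
    (hup' : ∀ k ∉ Sup, μ ≤ -(t * (2 * ∑ i, Real.cos (latticeMomentum L k i))))
    (hdn : ∀ k ∈ Sdn, -(t * (2 * ∑ i, Real.cos (latticeMomentum L k i))) ≤ μ)
    (hdn' : ∀ k ∉ Sdn, μ ≤ -(t * (2 * ∑ i, Real.cos (latticeMomentum L k i)))) :
    groundEnergyAt (fermionTorusGraph d L) t 0 (Sup.card + Sdn.card) =
      -(∑ k ∈ Sup, t * (2 * ∑ i, Real.cos (latticeMomentum L k i))) -
        (∑ k ∈ Sdn, t * (2 * ∑ i, Real.cos (latticeMomentum L k i))) := by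
  classical
  -- upper bound: the plane-wave Slater determinant, `U = 0`
  have hU := hubbardTorus_groundEnergyAt_le_freeFermion_momentum (d := d) (L := L) hL t 0 Sup Sdn
  rw [zero_mul, zero_div, add_zero] at hU
  -- lower bound: the bathtub at level `μ`
  have hLo := FreeKinetic.hubbardTorus_groundEnergyAt_ge (d := d) (L := L) hL t (le_refl (0 : ℝ)) μ
    (N := Sup.card + Sdn.card) (card_add_card_le_two_mul_pow Sup Sdn)
  set ε : TorusSite d L → ℝ := fun k => -(t * (2 * ∑ i, Real.cos (latticeMomentum L k i))) with hε
  have hsum : ∑ z : TorusSite d L, min (sdwBand t (cellCorner z) - μ) 0 = ∑ z, min (ε z - μ) 0 :=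
    Finset.sum_congr rfl fun z _ => by rw [sdwBand_cellCorner_eq]
  have hSu := sum_min_sub_eq_of_fermiLevel ε μ Sup hup hup'
  have hSd := sum_min_sub_eq_of_fermiLevel ε μ Sdn hdn hdn'
  have hεu : ∑ k ∈ Sup, ε k = -(∑ k ∈ Sup, t * (2 * ∑ i, Real.cos (latticeMomentum L k i))) := by
    simp only [hε, Finset.sum_neg_distrib]
  have hεd : ∑ k ∈ Sdn, ε k = -(∑ k ∈ Sdn, t * (2 * ∑ i, Real.cos (latticeMomentum L k i))) := by
    simp only [hε, Finset.sum_neg_distrib]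
  rw [hsum] at hLo
  have hcast : ((Sup.card + Sdn.card : ℕ) : ℝ) = (Sup.card : ℝ) + (Sdn.card : ℝ) := by push_cast; ring
  rw [hcast] at hLo
  -- `μN + 2Σ min = Σ_{S↑} ε + Σ_{S↓} ε`
  have key : μ * ((Sup.card : ℝ) + (Sdn.card : ℝ)) + 2 * ∑ z, min (ε z - μ) 0 =
      ∑ k ∈ Sup, ε k + ∑ k ∈ Sdn, ε k := by
    have : 2 * ∑ z, min (ε z - μ) 0 = (∑ k ∈ Sup, ε k - μ * Sup.card) + (∑ k ∈ Sdn, ε k - μ * Sdn.card) := by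
      rw [two_mul]; nth_rewrite 1 [hSu]; rw [hSd]
    rw [this]; ring
  rw [key, hεu, hεd] at hLo
  exact le_antisymm hU (by linarith)

/-- The same with a SINGLE Fermi sea used for both spins (the paramagnetic closed- or open-shell
filling `N = 2|S|`). [cite: LiebLoss1993, §8, Theorem 8.2] -/
theorem hubbardTorus_groundEnergyAt_zero_eq_two_mul (hL : 3 ≤ L) (t μ : ℝ) (S : Finset (TorusSite d L))
    (hS : ∀ k ∈ S, -(t * (2 * ∑ i, Real.cos (latticeMomentum L k i))) ≤ μ)
    (hS' : ∀ k ∉ S, μ ≤ -(t * (2 * ∑ i, Real.cos (latticeMomentum L k i)))) :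
    groundEnergyAt (fermionTorusGraph d L) t 0 (2 * S.card) =
      -(2 * ∑ k ∈ S, t * (2 * ∑ i, Real.cos (latticeMomentum L k i))) := by
  have h := hubbardTorus_groundEnergyAt_zero_eq hL t μ S S hS hS' hS hS'
  rw [← two_mul] at h
  rw [h]; ring

/-! ### §2 The `4 × 4` torus at `t = 1`, `U = 0`: `E_16 = E_14 = -24` exactly -/

/-- `cos(2π·0/4) = 1`. [folklore] -/
private theorem cos4_0 : Real.cos (2 * Real.pi * 0 / 4) = 1 := by
  rw [show (2 * Real.pi * 0 / 4 : ℝ) = 0 by ring]; exact Real.cos_zero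

/-- `cos(2π·1/4) = 0`. [folklore] -/
private theorem cos4_1 : Real.cos (2 * Real.pi * 1 / 4) = 0 := by
  rw [show (2 * Real.pi * 1 / 4 : ℝ) = Real.pi / 2 by ring]; exact Real.cos_pi_div_two

/-- `cos(2π·2/4) = -1`. [folklore] -/
private theorem cos4_2 : Real.cos (2 * Real.pi * 2 / 4) = -1 := by
  rw [show (2 * Real.pi * 2 / 4 : ℝ) = Real.pi by ring]; exact Real.cos_pi

/-- `cos(2π·3/4) = 0`. [folklore] -/
private theorem cos4_3 : Real.cos (2 * Real.pi * 3 / 4) = 0 := by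
  rw [show (2 * Real.pi * 3 / 4 : ℝ) = Real.pi / 2 + Real.pi by ring, Real.cos_add_pi,
    Real.cos_pi_div_two, neg_zero]

/-- The plane-wave level at an explicit momentum given by natural-number representatives. [folklore] -/
private theorem level_natCast (L a b : ℕ) [NeZero L] :
    (2 * ∑ i : Fin 2, Real.cos (latticeMomentum L (![((a : ℕ) : ZMod L), ((b : ℕ) : ZMod L)]) i)) =
      2 * (Real.cos (2 * Real.pi * ((a % L : ℕ) : ℝ) / L) + Real.cos (2 * Real.pi * ((b % L : ℕ) : ℝ) / L)) := by
  simp only [latticeMomentum, Fin.sum_univ_two, Matrix.cons_val_zero, Matrix.cons_val_one, ZMod.val_natCast]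

/-- `E_N(1, t'=0, U)` on the `4 × 4` torus in the `t–t'` presentation is the pure Hubbard sector energy. [folklore] -/
private theorem groundEnergy_TT'_zero_four (U : ℝ) (N : ℕ) :
    groundEnergy (hubbardTorusTT' 4 1 0 U) N = groundEnergyAt (fermionTorusGraph 2 4) 1 U N := by
  rw [hubbardTorusTT'_zero]; rfl

/-- **`4 × 4` torus, `t = 1`, `U = 0`, half filling: `E_16 = -24` exactly** (Fermi sea: the level
`-4` ×1 and `-2` ×4 per spin filled, three plane waves per spin in the six-fold zero shell).
Lower side: the tree's bathtub floor `groundEnergy_hubbardTorusTT'_four_N16_ge` at `t' = 0`; upper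
side: the explicit plane-wave determinant. [cite: LiebLoss1993, §8, Theorem 8.2] -/
theorem hubbardTorus44_groundEnergyAt_one_zero_sixteen :
    groundEnergyAt (fermionTorusGraph 2 4) 1 0 16 = -24 := by
  haveI : NeZero (4 : ℕ) := ⟨by norm_num⟩
  -- lower bound
  have hlo := groundEnergy_hubbardTorusTT'_four_N16_ge 0 (by norm_num) le_rfl (U := 0) le_rfl
  rw [groundEnergy_TT'_zero_four] at hlo
  -- upper bound: S↑ = S↓ = {(0,0),(0,1),(0,3),(1,0),(3,0),(0,2),(2,0),(1,1)}
  have hn : ([![((0 : ℕ) : ZMod 4), ((0 : ℕ) : ZMod 4)], ![((0 : ℕ) : ZMod 4), ((1 : ℕ) : ZMod 4)],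
      ![((0 : ℕ) : ZMod 4), ((3 : ℕ) : ZMod 4)], ![((1 : ℕ) : ZMod 4), ((0 : ℕ) : ZMod 4)],
      ![((3 : ℕ) : ZMod 4), ((0 : ℕ) : ZMod 4)], ![((0 : ℕ) : ZMod 4), ((2 : ℕ) : ZMod 4)],
      ![((2 : ℕ) : ZMod 4), ((0 : ℕ) : ZMod 4)], ![((1 : ℕ) : ZMod 4), ((1 : ℕ) : ZMod 4)]] :
      List (TorusSite 2 4)).Nodup := by decide
  have h := hubbardTorus_groundEnergyAt_le_freeFermion_momentum (d := 2) (L := 4) (by norm_num)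
    (1 : ℝ) (0 : ℝ)
    ([![((0 : ℕ) : ZMod 4), ((0 : ℕ) : ZMod 4)], ![((0 : ℕ) : ZMod 4), ((1 : ℕ) : ZMod 4)],
      ![((0 : ℕ) : ZMod 4), ((3 : ℕ) : ZMod 4)], ![((1 : ℕ) : ZMod 4), ((0 : ℕ) : ZMod 4)],
      ![((3 : ℕ) : ZMod 4), ((0 : ℕ) : ZMod 4)], ![((0 : ℕ) : ZMod 4), ((2 : ℕ) : ZMod 4)],
      ![((2 : ℕ) : ZMod 4), ((0 : ℕ) : ZMod 4)], ![((1 : ℕ) : ZMod 4), ((1 : ℕ) : ZMod 4)]] :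
      List (TorusSite 2 4)).toFinset
    ([![((0 : ℕ) : ZMod 4), ((0 : ℕ) : ZMod 4)], ![((0 : ℕ) : ZMod 4), ((1 : ℕ) : ZMod 4)],
      ![((0 : ℕ) : ZMod 4), ((3 : ℕ) : ZMod 4)], ![((1 : ℕ) : ZMod 4), ((0 : ℕ) : ZMod 4)],
      ![((3 : ℕ) : ZMod 4), ((0 : ℕ) : ZMod 4)], ![((0 : ℕ) : ZMod 4), ((2 : ℕ) : ZMod 4)],
      ![((2 : ℕ) : ZMod 4), ((0 : ℕ) : ZMod 4)], ![((1 : ℕ) : ZMod 4), ((1 : ℕ) : ZMod 4)]] :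
      List (TorusSite 2 4)).toFinset
  rw [List.toFinset_card_of_nodup hn, List.sum_toFinset _ hn] at h
  simp only [List.length_cons, List.length_nil, List.map_cons, List.map_nil, List.sum_cons, List.sum_nil,
    one_mul, level_natCast, Nat.reduceMod, Nat.reduceAdd] at h
  simp only [Nat.cast_zero, Nat.cast_one, Nat.cast_ofNat, cos4_0, cos4_1, cos4_2, cos4_3] at h
  norm_num at h hlo ⊢
  linarith

/-- **`4 × 4` torus, `t = 1`, `U = 0`, filling 7/8: `E_14 = -24` exactly** (the two Fermi seas
differ from the half-filled ones only inside the zero shell). [cite: LiebLoss1993, §8, Theorem 8.2] -/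
theorem hubbardTorus44_groundEnergyAt_one_zero_fourteen :
    groundEnergyAt (fermionTorusGraph 2 4) 1 0 14 = -24 := by
  haveI : NeZero (4 : ℕ) := ⟨by norm_num⟩
  have hlo := groundEnergy_hubbardTorusTT'_four_N14_ge 0 (by norm_num) le_rfl (U := 0) le_rfl
  rw [groundEnergy_TT'_zero_four] at hlo
  -- S↑ = S↓ = {(0,0),(0,1),(0,3),(1,0),(3,0),(0,2),(2,0)}
  have hn : ([![((0 : ℕ) : ZMod 4), ((0 : ℕ) : ZMod 4)], ![((0 : ℕ) : ZMod 4), ((1 : ℕ) : ZMod 4)],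
      ![((0 : ℕ) : ZMod 4), ((3 : ℕ) : ZMod 4)], ![((1 : ℕ) : ZMod 4), ((0 : ℕ) : ZMod 4)],
      ![((3 : ℕ) : ZMod 4), ((0 : ℕ) : ZMod 4)], ![((0 : ℕ) : ZMod 4), ((2 : ℕ) : ZMod 4)],
      ![((2 : ℕ) : ZMod 4), ((0 : ℕ) : ZMod 4)]] : List (TorusSite 2 4)).Nodup := by decide
  have h := hubbardTorus_groundEnergyAt_le_freeFermion_momentum (d := 2) (L := 4) (by norm_num)
    (1 : ℝ) (0 : ℝ)
    ([![((0 : ℕ) : ZMod 4), ((0 : ℕ) : ZMod 4)], ![((0 : ℕ) : ZMod 4), ((1 : ℕ) : ZMod 4)],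
      ![((0 : ℕ) : ZMod 4), ((3 : ℕ) : ZMod 4)], ![((1 : ℕ) : ZMod 4), ((0 : ℕ) : ZMod 4)],
      ![((3 : ℕ) : ZMod 4), ((0 : ℕ) : ZMod 4)], ![((0 : ℕ) : ZMod 4), ((2 : ℕ) : ZMod 4)],
      ![((2 : ℕ) : ZMod 4), ((0 : ℕ) : ZMod 4)]] : List (TorusSite 2 4)).toFinset
    ([![((0 : ℕ) : ZMod 4), ((0 : ℕ) : ZMod 4)], ![((0 : ℕ) : ZMod 4), ((1 : ℕ) : ZMod 4)],
      ![((0 : ℕ) : ZMod 4), ((3 : ℕ) : ZMod 4)], ![((1 : ℕ) : ZMod 4), ((0 : ℕ) : ZMod 4)],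
      ![((3 : ℕ) : ZMod 4), ((0 : ℕ) : ZMod 4)], ![((0 : ℕ) : ZMod 4), ((2 : ℕ) : ZMod 4)],
      ![((2 : ℕ) : ZMod 4), ((0 : ℕ) : ZMod 4)]] : List (TorusSite 2 4)).toFinset
  rw [List.toFinset_card_of_nodup hn, List.sum_toFinset _ hn] at h
  simp only [List.length_cons, List.length_nil, List.map_cons, List.map_nil, List.sum_cons, List.sum_nil,
    one_mul, level_natCast, Nat.reduceMod, Nat.reduceAdd] at h
  simp only [Nat.cast_zero, Nat.cast_one, Nat.cast_ofNat, cos4_0, cos4_1, cos4_2, cos4_3] at h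
  norm_num at h hlo ⊢
  linarith

end FreeFermionTorus

end Literature.MathematicalPhysics.QuantumLattice
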